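import Summits.BirchSwinnertonDyer.BirchSwinnertonDyer.Theses.PrintX8VS
import Summits.BirchSwinnertonDyer.BirchSwinnertonDyer.Theorems.PrintX8VSGlue
import Summits.BirchSwinnertonDyer.BirchSwinnertonDyer.Theorems.PrintX8VSConjSpanGenAll
import HarnessLib

/-!
# Route `PrintX8VS`, director-bsd W-82 «RANK CUT» step (1): the span glue of the x8 residual CUT TO THE
# ROUTE'S RANGE `r_an ≤ 1` — `K1≤1 → ConjSpanGenAll → InputSharpFlatMuTransfer → PublishedInputsX8 →
# SharpFlatMainConjectureX8` — PROVED, by name, from landed theorems (cell `bsd-print-x8`; text = the x8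
# planner's certified sketch `rankcut-W82-g30/RankCutSketch.lean` §E, farm rc 0)

HONEST FRAMING: pure re-plumbing, no new mathematics. The target `SharpFlatMainConjectureX8` (C1 of route
`PrintX8`, item 20304) is typed at the X8 pairs with `W.analyticRank ≤ 1` only, and both closed x8 glues
(`PrintX8MuBoundGlue.glueMuBoundSmallImageX8_holds`, `PrintX8MainConjectureSplit.glueMainConjectureX8_holds`)
invoke the residual K1 `SprungLowerDivisibilityAtThree` (item 19875, CLASS-WIDE as filed) per pair with that
rank hypothesis in scope. Hence the glue already holds from the WEAKER, rank-cut residual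
`K1≤1 := ∀ X8 pairs (W, p) with W.analyticRank ≤ 1, ∀ •, SprungSharpFlatLowerDivisibility W p •` (spelled out
below; it becomes the route item `SprungLowerDivisibilityAtThreeRankLeOne` at the W-82 edit, and this theorem
then closes the glue item `GlueMainConjectureOfSpanX8RankLeOne` by `exact`). Per pair: big image `surj(3)` ⟹
`X8.sprungSharpFlatMainConjecture_of_lowerDivisibility_of_surj` (Λ a UFD, Kato `n = 0`); small image ⟹ the
`μ`-criterion `PrintX8MuReading.X8.sprungSharpFlatMainConjecture_of_lowerDivisibility_of_muInvariant_le` fed by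
THEOREM B's consequence `PrintX8VSGlue.muBoundSmallImageX8_of_conjSpanGenAll`. The r_an ≥ 2 X8 pairs — where
K1 as filed also quantifies, and where the lead's registered stub S4b-T (signed 3-adic BSD rank inequality at
`(T)`) would be needed — never enter the x8 cone. No census cell moves; PARTITION 0; K1 / K1≤1 remain OPEN
IN PRINT at `a₃ = ±3`; BSD is not proved by any of this; «beyond-print theorem: NO» (bookkeeping).

Landed by the width seat `cruxlead-stmt-BirchSwinnertonDyer-19875-w2` (g3) as first taker of the x8 planner's ready file (sha16
157d77eaef98d46a) with ONE change forced by the gate: the THEOREM-B-discharged corollary `wAllCornerX8_of_rankLeOne` is the already-landed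
`ChromaticCommonZeros.wAllCornerX8_of_lowerDivisibility_analyticRank_le_one` (p622442) and is cited, not restated.

References: route file `Theses/PrintX8VS.lean` (items 19875, 21705, 21706, 20304); x8 planner sketch
`run/shared/lean/pub/bsd-print-x8/bsd-print-x8-plan/rankcut-W82-g30/RankCutSketch.lean` (§E/§F);
[Sprung2012] Thm. 7.14, Thm. 7.16, Prop. 7.19, Main Conj. 7.21; [Pollack2003] Def. 6.15; [Wuthrich2014] Lemma 20;
[Miller2011LMS] Def. 1.1.
-/

set_option autoImplicit false
-- justification: the mandated namespace `Summit.BirchSwinnertonDyer.BirchSwinnertonDyer.Theorems`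
-- (single-conjunct summit, Sub = Summit) repeats a segment by design (D-0017).
set_option linter.dupNamespace false

noncomputable section

namespace Summit.BirchSwinnertonDyer.BirchSwinnertonDyer.Theorems.PrintX8VSGlueRankLeOne

open Literature.NumberTheory.EllipticCurves Literature.NumberTheory.EllipticCurves.Rank1Residual
  Literature.NumberTheory.EllipticCurves.Sprung2017
  Summit.BirchSwinnertonDyer.BirchSwinnertonDyer.Theorems
  Summit.BirchSwinnertonDyer.BirchSwinnertonDyer.Theses

/-- **W-82 (1): the span glue from the RANK-CUT residual** — `K1≤1 → ConjSpanGenAll → InputSharpFlatMuTransfer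
→ PublishedInputsX8 → SharpFlatMainConjectureX8`, with `K1≤1` spelled out (= item-19875's signature with the
binder `W.analyticRank ≤ 1` inserted; the W-82 route item `PrintX8VS.SprungLowerDivisibilityAtThreeRankLeOne`
unfolds to it verbatim). SPAN + held input 20771 ⟹ Mu (`PrintX8VSGlue.muBoundSmallImageX8_of_conjSpanGenAll`);
per X8 pair of analytic rank `≤ 1`: `surj(3)` ⟹ the big-image criterion, else the `μ`-criterion.
[cite: Sprung2012, Thm. 7.14, Thm. 7.16, Prop. 7.19 and Main Conj. 7.21] [cite: Pollack2003, Def. 6.15]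
[cite: Wuthrich2014, Lemma 20] -/
theorem glueMainConjectureOfSpanX8RankLeOne_holds :
    (∀ (W : WeierstrassCurve ℚ) [W.IsElliptic] [W.IsGloballyMinimal] (p : ℕ) [Fact p.Prime],
        ClassX8 W p → W.analyticRank ≤ 1 → ∀ col : Chroma, SprungSharpFlatLowerDivisibility W p col) →
      PrintX8VS.ConjSpanGenAll → PrintX8VS.InputSharpFlatMuTransfer → PrintX8VS.PublishedInputsX8 →
        PrintX8VS.SharpFlatMainConjectureX8 := by
  intro hK1 hSpan hIn hPub
  have hμ := PrintX8VSGlue.muBoundSmallImageX8_of_conjSpanGenAll hSpan hIn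
  obtain ⟨-, -, -, h714, h716, -, h3, -⟩ := hPub
  intro W _ _ p _ hX hr col
  by_cases hs : Surj W p
  · exact X8.sprungSharpFlatMainConjecture_of_lowerDivisibility_of_surj h714 h716 h3 W p hX hs col
      (hK1 W p hX hr col)
  · exact PrintX8MuReading.X8.sprungSharpFlatMainConjecture_of_lowerDivisibility_of_muInvariant_le h714 h716
      h3 W p hX col (hK1 W p hX hr col) (hμ W p hX hs hr col)

/-- **The X8 leaf from the RANK-CUT residual + THEOREM B + the held/published items + GZK, in one kernel
theorem** (= the W-82 deciding theorem `closes82` of the x8 planner's sketch with the four proved glue /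
assembly items DISCHARGED: `PrintX8VSGlue.assembly_holds`, this file's span glue,
`PrintX8VSGlue.glueRankOneLinkX8_holds`, `glueRankZeroLinkX8_holds`). [cite: Miller2011LMS, §1 and Def. 1.1]
[cite: Sprung2012, Main Conj. 7.21] -/
theorem wAllCornerX8_of_rankLeOne_of_conjSpanGenAll
    (hK1 : ∀ (W : WeierstrassCurve ℚ) [W.IsElliptic] [W.IsGloballyMinimal] (p : ℕ) [Fact p.Prime],
        ClassX8 W p → W.analyticRank ≤ 1 → ∀ col : Chroma, SprungSharpFlatLowerDivisibility W p col)
    (hSpan : PrintX8VS.ConjSpanGenAll) (hIn : PrintX8VS.InputSharpFlatMuTransfer)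
    (hPub : PrintX8VS.PublishedInputsX8) (hGZK : PrintX8VS.RankEqAnalyticRankLeOne) :
    Summit.BirchSwinnertonDyer.WAllCornerX8 :=
  PrintX8VSGlue.assembly_holds (glueMainConjectureOfSpanX8RankLeOne_holds hK1 hSpan hIn hPub)
    (PrintX8VSGlue.glueRankOneLinkX8_holds hPub hGZK) (PrintX8VSGlue.glueRankZeroLinkX8_holds hPub hGZK) hGZK

-- The THEOREM-B-discharged form «leaf ⟸ K1≤1 + InputSharpFlatMuTransfer + PublishedInputsX8 + GZK» of the x8 planner's
-- sketch (`wAllCornerX8_of_rankLeOne`) is ALREADY LANDED, statement verbatim, as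
-- `Summit.BirchSwinnertonDyer.BirchSwinnertonDyer.Theorems.ChromaticCommonZeros.wAllCornerX8_of_lowerDivisibility_analyticRank_le_one`
-- (`Theorems/PrintX8VSWAllCornerX8OfRankCut.lean`, p622442) — cite that declaration; not restated here (gate `dedup.landed`).

end Summit.BirchSwinnertonDyer.BirchSwinnertonDyer.Theorems.PrintX8VSGlueRankLeOne

end
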